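import Literature.NumberTheory.Automorphic.HarishChandraFinitenessGLOne
import Literature.NumberTheory.Automorphic.AutomorphicTwistNorm
import Literature.NumberTheory.Automorphic.GLnCuspidalSpectrumSiegel
import Literature.NumberTheory.Automorphic.UnramifiedHeckeScalarsProofs
import Literature.Analysis.Complex.CircleHomomorphisms
import Mathlib.Topology.Instances.RealVectorSpace
import HarnessLib

/-!
# Hecke characters as automorphic forms and automorphic representations of `GL_1(𝔸_K)` in the
# Borel–Jacquet model

Topic `NumberTheory/Automorphic`; proof file (theorems only: no definition, no named fact, no
instance), the Borel–Jacquet-model companion of `GLOneOfHeckeCharacter` (which realises Hecke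
characters in the tree's `L²` model `CuspidalAutomorphicRepGL 1 K μ`). Here the target is the model
of `AutomorphicRepsGL` / `AutomorphicForms` — `IsAutomorphicForm (AutomorphyDatum.gl 1 K hcpt)`,
`AutomorphicRepData`, `AutomorphicRepData.HasSatakeParamAt` — in which the base-change statement
`exists_baseChange_cyclic` (`BaseChangeGLn`, **lang.S23**) and the Langlands–Tunnell files are
written. For an idèle class character `θ` of the number field `K` (`HeckeCharacter K`, continuous,
trivial on `Kˣ`, no unitarity assumed) we prove:

* `exists_eq_exp_mul_of_continuous_hom`, `exists_linearMap_exp_eq` — continuous one-parameter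
  groups `ℝ → ℂˣ` are `t ↦ e^{μt}`, and a multiplicative nowhere-zero function on a real vector
  space that is continuous along lines is `exp ∘ δ` for a real-linear `δ` (from the tree's unitary
  case `Literature.Analysis.Complex.exists_eq_exp_of_continuous_unitary_hom` and Mathlib's
  `map_real_smul`).
* `exists_linearMap_detTwist_ofArch_expMem_glOne` — **the archimedean differential of `θ`**: a
  real-linear `δ : 𝔤𝔩_1(K_∞) → ℂ` with `θ(det(exp X, 1)) = e^{δ(X)}`.
* `HeckeCharacter.exists_norm_apply_eq_ideleNorm_rpow` — **`|θ| = ‖·‖^σ`** for a real `σ`: every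
  Hecke character is unitary up to a real power of the idèle norm. Proved on `GL_1(𝔸_K)`
  (`HeckeCharacter.exists_norm_detTwist_eq_ideleNorm_rpow`) from reduction theory for `GL_1`
  (`reductionTheory_gl_holds 1 K`: `GL_1(𝔸_K) = GL_1(K) · A_G · Ω · K` with `Ω̄ K` compact, i.e. the
  compactness of `𝕀_K¹/Kˣ`): the continuous homomorphism `|θ ∘ det| · ‖det‖^{-σ}`,
  `σ = re δ(1)/[K:ℚ]`, is trivial on `GL_1(K)` and on `A_G`, hence bounded, hence trivial.
* `isAutomorphicForm_detTwist_glOne` — **`g ↦ θ(det g)` is an automorphic form on `GL_1(𝔸_K)`**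
  (Borel–Jacquet 1979, 4.2 (a)–(d)): level from `HeckeCharacter.exists_level_glOne` (no small
  subgroups), smoothness from the differential, `K_∞`- and `Z(𝔤)`-finiteness because every
  translate and every derivative of `θ∘det` is a multiple of it (`rightTranslation_detTwist_glOne`,
  `lieDeriv_detTwist_glOne`, `applyFree_detTwist_glOne_mem`), moderate growth from `|θ| = ‖·‖^σ`
  and `exists_ideleNorm_det_rpow_le_height`.
* `exists_automorphicRepData_detTwist_glOne` — **the automorphic representation `π_θ = ℂ·(θ∘det)/⊥`
  of `GL_1(𝔸_K)`** (a line is irreducible), and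
  `AutomorphicRepData.hasSatakeParamAt_detTwist_glOne` — **its Satake parameter at every `w` prime
  to a level `𝔪` of `θ` is `{θ(⟨ϖ⟩_w)}`**, for every uniformizer `ϖ` of `K_w` (in rank one the
  Hecke operator `T_{w,1}` on `K(𝔪)`-fixed functions is `r(t_{w,1})`,
  `heckeOperator_rightTranslation_glOne`, and `det t_{w,1} = ⟨ϖ⟩_w`).

This is the rank-one dictionary "automorphic representations of `GL(1)` = idèle class characters"
(Gelbart 1975, §2.A; Jacquet–Langlands 1970, §9; Borel–Jacquet 1979, 4.6) on the Borel–Jacquet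
side, the input over `E` of base change for `GL(1)` in the Borel–Jacquet model
(`χ ↦ χ ∘ N_{E/F}`, Arthur–Clozel 1989, Ch. 3, §1 and Thm. 4.2 at `n = 1`).

## References

* A. Borel, H. Jacquet, *Automorphic forms and automorphic representations*, Proc. Sympos. Pure
  Math. 33 (Corvallis 1979), part 1, §4.2–4.6 [BorelJacquet1979].
* S. Gelbart, *Automorphic forms on adele groups*, Ann. of Math. Stud. 83 (1975), §2.A
  [Gelbart1975].
* J. Tate, *Fourier analysis in number fields and Hecke's zeta-functions* (1950), §2.3, Lemma
  3.2.1, §4.3, in Cassels–Fröhlich (1967), Ch. XV [TateThesis1967].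
* A. Weil, *Basic Number Theory* (1967), Ch. IV §4, Thm. 6 [WeilBNT1967].
* E. Hewitt, K. A. Ross, *Abstract Harmonic Analysis I* (1963), (23.27) (continuous characters of
  `ℝ`).
-/

noncomputable section

open scoped MatrixGroups NNReal Classical Pointwise ContDiff
open NumberField IsDedekindDomain

namespace Literature.NumberTheory.Automorphic

open Literature.NumberTheory.GaloisRepresentations (HeckeCharacter ideleGroup localUnits)

/-! ### Continuous one-parameter groups in `ℂˣ` are exponentials -/

section OneParameter

open Complex in
/-- **Continuous one-parameter groups in `ℂˣ` are exponentials**: a continuous `f : ℝ → ℂ` with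
`f t ≠ 0` and `f (s + t) = f s * f t` is `t ↦ e^{μ t}` for a complex `μ` (polar decomposition:
`log ‖f‖` is continuous additive, hence linear — Mathlib `map_real_smul` —, and `f · e^{-at}` is a
continuous unitary one-parameter group, `exists_eq_exp_of_continuous_unitary_hom`).
Hewitt–Ross, *Abstract Harmonic Analysis I*, (23.27). [folklore] -/
theorem exists_eq_exp_mul_of_continuous_hom {f : ℝ → ℂ} (hf : Continuous f) (h0 : ∀ t, f t ≠ 0)
    (hmul : ∀ s t, f (s + t) = f s * f t) : ∃ μ : ℂ, ∀ t : ℝ, f t = exp (μ * t) := by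
  -- the additive continuous function `L = log ‖f‖` is linear
  set L : ℝ → ℝ := fun t => Real.log ‖f t‖ with hL
  have hn0 : ∀ t, ‖f t‖ ≠ 0 := fun t => norm_ne_zero_iff.2 (h0 t)
  have hLadd : ∀ s t, L (s + t) = L s + L t := fun s t => by
    simp only [hL, hmul, norm_mul, Real.log_mul (hn0 s) (hn0 t)]
  have hLc : Continuous L := (hf.norm).log hn0
  let Lh : ℝ →+ ℝ := AddMonoidHom.mk' L hLadd
  set a : ℝ := L 1 with ha
  have hLlin : ∀ t, L t = t * a := fun t => by
    have h := map_real_smul Lh hLc t 1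
    simp only [smul_eq_mul, mul_one] at h
    exact h
  have hnorm : ∀ t, ‖f t‖ = Real.exp (t * a) := fun t => by
    rw [← hLlin, hL, Real.exp_log (norm_pos_iff.2 (h0 t))]
  -- the unitary part `g t = f t · e^{-a t}`
  set g : ℝ → ℂ := fun t => f t * exp (-(a : ℂ) * t) with hg
  have hgc : Continuous g :=
    hf.mul (continuous_exp.comp (continuous_const.mul continuous_ofReal))
  have hexpn : ∀ t : ℝ, ‖exp (-(a : ℂ) * t)‖ = Real.exp (-(t * a)) := fun t => by
    rw [norm_exp]
    congr 1
    simp [mul_comm]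
  have hg1 : ∀ t, ‖g t‖ = 1 := fun t => by
    simp only [hg, norm_mul, hexpn, hnorm, ← Real.exp_add, add_neg_cancel, Real.exp_zero]
  have hgmul : ∀ s t, g (s + t) = g s * g t := fun s t => by
    simp only [hg, hmul, ofReal_add]
    rw [show -(a : ℂ) * (s + t) = -(a : ℂ) * s + -(a : ℂ) * t by ring, exp_add]
    ring
  obtain ⟨k, hk⟩ := Literature.Analysis.Complex.exists_eq_exp_of_continuous_unitary_hom hgc hg1 hgmul
  refine ⟨(a : ℂ) + k * I, fun t => ?_⟩
  have hft : f t = g t * exp ((a : ℂ) * t) := by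
    simp only [hg]
    rw [mul_assoc, ← exp_add, show -(a : ℂ) * t + a * t = 0 by ring, exp_zero, mul_one]
  rw [hft, hk, ← exp_add]
  congr 1
  ring

open Complex in
/-- Uniqueness of the exponent: `e^{a t} = e^{b t}` for all real `t` forces `a = b` (compare the
derivatives at `t = 0`). [folklore] -/
theorem eq_of_forall_exp_mul_eq {a b : ℂ} (h : ∀ t : ℝ, exp (a * t) = exp (b * t)) : a = b := by
  have hd : ∀ c : ℂ, HasDerivAt (fun t : ℝ => exp (c * t)) c 0 := fun c => by
    have h1 : HasDerivAt (fun t : ℝ => c * (t : ℂ)) c 0 := by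
      simpa using ((hasDerivAt_id (0 : ℝ)).ofReal_comp).const_mul c
    simpa using h1.cexp
  have hfun : (fun t : ℝ => exp (a * t)) = fun t : ℝ => exp (b * t) := funext h
  have hda := hd a
  rw [hfun] at hda
  exact hda.unique (hd b)

/-- **Directionally continuous characters of a real vector space are exponentials of linear
forms**: if `f : V → ℂ` is multiplicative (`f (x + y) = f x * f y`), nowhere zero, and continuous
along every line `t ↦ f (t • x)`, then `f = exp ∘ δ` for a real-linear `δ : V → ℂ` (each
restriction to a line is `e^{μ(x) t}`, and `μ` is additive and homogeneous by uniqueness of the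
exponent). Hewitt–Ross (23.27), along lines. [folklore] -/
theorem exists_linearMap_exp_eq {V : Type*} [AddCommGroup V] [Module ℝ V] {f : V → ℂ}
    (hf : ∀ x, Continuous fun t : ℝ => f (t • x)) (h0 : ∀ x, f x ≠ 0)
    (hmul : ∀ x y, f (x + y) = f x * f y) :
    ∃ δ : V →ₗ[ℝ] ℂ, ∀ x, f x = Complex.exp (δ x) := by
  have hline : ∀ x, ∃ μ : ℂ, ∀ t : ℝ, f (t • x) = Complex.exp (μ * t) := fun x =>
    exists_eq_exp_mul_of_continuous_hom (hf x) (fun t => h0 _) fun s t => by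
      rw [add_smul, hmul]
  choose μ hμ using hline
  have hadd : ∀ x y, μ (x + y) = μ x + μ y := fun x y => by
    refine eq_of_forall_exp_mul_eq fun t => ?_
    rw [← hμ, smul_add, hmul, hμ, hμ, ← Complex.exp_add]
    congr 1; ring
  have hsmul : ∀ (c : ℝ) x, μ (c • x) = c • μ x := fun c x => by
    refine eq_of_forall_exp_mul_eq fun t => ?_
    rw [← hμ, smul_smul, hμ]
    congr 1
    simp only [Complex.real_smul, Complex.ofReal_mul]
    ring
  refine ⟨{ toFun := μ, map_add' := hadd, map_smul' := hsmul }, fun x => ?_⟩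
  have := hμ x 1
  rw [one_smul] at this
  simpa using this

end OneParameter

/-! ### The archimedean differential and the absolute value of a Hecke character -/

section Character

variable {K : Type} [Field K] [NumberField K]

/-- `exp (X + Y) = exp X · exp Y` in `GL_1(K_∞)` (`𝔤𝔩_1` is commutative). [folklore] -/
theorem expMem_add_glOne (hcpt : isCompact_glFiniteIntegralLevel 1 K)
    (X Y : (AutomorphyDatum.gl 1 K hcpt).arch.lie) :
    (AutomorphyDatum.gl 1 K hcpt).arch.expMem (X + Y) =
      (AutomorphyDatum.gl 1 K hcpt).arch.expMem X * (AutomorphyDatum.gl 1 K hcpt).arch.expMem Y :=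
  RealMatrixGroup.expMem_add_of_commute X Y (commute_matrix_fin_one _ _)

/-- **The archimedean differential of a Hecke character.** For every idele class character `θ`
of `K` there is a real-linear `δ : 𝔤𝔩_1(K_∞) → ℂ` with `θ (det (exp X, 1)) = e^{δ(X)}`:
`X ↦ θ(det(exp X, 1))` is a character of the additive group `𝔤𝔩_1(K_∞)` (commutative), continuous
along lines, hence the exponential of a linear form (`exists_linearMap_exp_eq`). This is the
statement "a quasi-character of `K_wˣ` is `x ↦ (x/|x|)^m |x|^s` near `1`" (Tate (1950), §2.3)
in coordinate-free form. [cite: TateThesis1967, §2.3] -/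
theorem exists_linearMap_detTwist_ofArch_expMem_glOne (hcpt : isCompact_glFiniteIntegralLevel 1 K)
    (θ : HeckeCharacter K) :
    ∃ δ : (AutomorphyDatum.gl 1 K hcpt).arch.lie →ₗ[ℝ] ℂ,
      ∀ X : (AutomorphyDatum.gl 1 K hcpt).arch.lie,
        (detTwist 1 θ ((AutomorphyDatum.gl 1 K hcpt).ofArch
          ((AutomorphyDatum.gl 1 K hcpt).arch.expMem X)) : ℂ) = Complex.exp (δ X) := by
  refine exists_linearMap_exp_eq (fun X => ?_) (fun X => Units.ne_zero _) fun X Y => ?_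
  · exact Units.continuous_val.comp ((continuous_detTwist 1 θ).comp
      ((AutomorphyDatum.gl 1 K hcpt).continuous_ofArch.comp (continuous_expMem_smul X)))
  · rw [expMem_add_glOne, map_mul, map_mul, Units.val_mul]

/-- A monoid homomorphism into the positive reals that is bounded above is trivial. [folklore] -/
theorem MonoidHom.eq_one_of_pos_of_bddAbove {G : Type*} [Group G] (f : G →* ℝ)
    (hpos : ∀ g, 0 < f g) {B : ℝ} (hB : ∀ g, f g ≤ B) (g : G) : f g = 1 := by
  have hinv : ∀ g, f g⁻¹ = (f g)⁻¹ := fun g =>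
    eq_inv_of_mul_eq_one_right (by rw [← map_mul, mul_inv_cancel, map_one])
  have key : ∀ g, ¬ 1 < f g := fun g hg => by
    obtain ⟨m, hm⟩ := pow_unbounded_of_one_lt B hg
    rw [← map_pow] at hm
    exact (lt_irrefl B) (hm.trans_le (hB _))
  rcases lt_trichotomy (f g) 1 with h | h | h
  · exfalso
    refine key g⁻¹ ?_
    rw [hinv]
    exact (one_lt_inv₀ (hpos g)).2 h
  · exact h
  · exact absurd h (key g)

/-- **The absolute value of a Hecke character is a power of the idele norm**:
`|θ(x)| = ‖x‖^σ` for a real `σ` (so `θ · ‖·‖^{-σ}` is unitary). Proof on `GL_1(𝔸_K)`: with `δ`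
the archimedean differential of `θ` and `σ = re δ(1) / [K:ℚ]`, the continuous homomorphism
`Φ(g) = |θ(det g)| · ‖det g‖^{-σ}` into `ℝ_{>0}` is trivial on `GL_1(K)` (`θ(Kˣ) = 1`, product
formula) and on the split component `A_G = {exp(t · 1)}` (`‖det e^t‖ = e^{t[K:ℚ]}`); by reduction
theory for `GL_1` (`GL_1(𝔸_K) = GL_1(K) · A_G · Ω · K`, `Ω̄ K` compact — i.e. the compactness of
`𝕀_K¹ / Kˣ`) it is bounded, hence trivial. Weil, *Basic Number Theory*, Ch. VII §3, Prop. 1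
with Ch. IV §4, Thm. 6; Tate (1950), §4.3. [cite: WeilBNT1967, Ch. IV §4, Thm. 6] -/
theorem HeckeCharacter.exists_norm_detTwist_eq_ideleNorm_rpow (hcpt : isCompact_glFiniteIntegralLevel 1 K)
    (θ : HeckeCharacter K) :
    ∃ σ : ℝ, ∀ g : GL (Fin 1) (AdeleRing (𝓞 K) K),
      ‖(detTwist 1 θ g : ℂ)‖ =
        ((IdeleClassGroup.ideleNorm K (Matrix.GeneralLinearGroup.det g) : ℝ≥0) : ℝ) ^ σ := by
  obtain ⟨δ, hδ⟩ := exists_linearMap_detTwist_ofArch_expMem_glOne hcpt θ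
  set c : ℝ := (δ (⟨1, trivial⟩ : (AutomorphyDatum.gl 1 K hcpt).arch.lie)).re with hc
  set d : ℕ := Module.finrank ℚ K with hd
  have hd0 : (d : ℝ) ≠ 0 := Nat.cast_ne_zero.2 Module.finrank_pos.ne'
  set σ : ℝ := c / d with hσ
  refine ⟨σ, ?_⟩
  -- the norm of the determinant, as a real-valued multiplicative function
  set N : GL (Fin 1) (AdeleRing (𝓞 K) K) → ℝ := fun g =>
    ((IdeleClassGroup.ideleNorm K (Matrix.GeneralLinearGroup.det g) : ℝ≥0) : ℝ) with hN
  have hNmul : ∀ g h, N (g * h) = N g * N h := fun g h => by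
    simp only [hN, map_mul, NNReal.coe_mul]
  have hNpos : ∀ g, 0 < N g := fun g =>
    NNReal.coe_pos.2 (pos_iff_ne_zero.2 (ideleNorm_ne_zero _))
  have hNc : Continuous N := NNReal.continuous_coe.comp
    ((continuous_ideleNorm_holds (K := K)).comp Matrix.GeneralLinearGroup.continuous_det)
  -- the homomorphism `Φ(g) = |θ(det g)| ‖det g‖^{-σ}`
  let Φ : GL (Fin 1) (AdeleRing (𝓞 K) K) →* ℝ :=
    { toFun := fun g => ‖(detTwist 1 θ g : ℂ)‖ * N g ^ (-σ)
      map_one' := by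
        simp only [detTwist_apply, map_one, Units.val_one, norm_one, one_mul, hN, NNReal.coe_one,
          Real.one_rpow]
      map_mul' := fun g h => by
        simp only [detTwist_apply, map_mul, Units.val_mul, norm_mul, hNmul]
        rw [Real.mul_rpow (hNpos g).le (hNpos h).le]
        ring }
  have hΦ : ∀ g, Φ g = ‖(detTwist 1 θ g : ℂ)‖ * N g ^ (-σ) := fun g => rfl
  have hΦpos : ∀ g, 0 < Φ g := fun g =>
    mul_pos (norm_pos_iff.2 (Units.ne_zero _)) (Real.rpow_pos_of_pos (hNpos g) _)
  have hΦc : Continuous Φ := by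
    change Continuous fun g => ‖(detTwist 1 θ g : ℂ)‖ * N g ^ (-σ)
    exact (Units.continuous_val.comp (continuous_detTwist 1 θ)).norm.mul
      (hNc.rpow_const fun g => Or.inl (hNpos g).ne')
  -- `Φ = 1` on `GL_1(K)`
  have hΦrat : ∀ γ ∈ rationalPointsGL 1 K, Φ γ = 1 := fun γ hγ => by
    rw [hΦ, detTwist_eq_one_of_mem_arithmeticSubgroup 1 θ hγ, Units.val_one, norm_one, one_mul]
    obtain ⟨γ₀, rfl⟩ := hγ
    have h1 : IdeleClassGroup.ideleNorm K (Matrix.GeneralLinearGroup.det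
        (Matrix.GeneralLinearGroup.map (algebraMap K (AdeleRing (𝓞 K) K)) γ₀)) = 1 :=
      ideleNorm_principal (GLn.det_toAdelic_mem_principalIdeles 1 γ₀)
    simp only [hN]
    rw [h1, NNReal.coe_one, Real.one_rpow]
  -- `Φ = 1` on `A_G`
  have hΦz : ∀ z ∈ (posRealScalar 1 K).range, Φ z = 1 := by
    rintro _ ⟨t, rfl⟩
    have ht : (0 : ℝ) < ((t : ℝ≥0) : ℝ) := NNReal.coe_pos.2 (pos_iff_ne_zero.2 t.ne_zero)
    rw [hΦ]
    have h1 : ‖(detTwist 1 θ (posRealScalar 1 K t) : ℂ)‖ =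
        Real.exp (Real.log ((t : ℝ≥0) : ℝ) * c) := by
      rw [posRealScalar_eq_ofArch_expMem (hcpt := hcpt) t, hδ, Complex.norm_exp, map_smul,
        Complex.smul_re, smul_eq_mul]
    have h2 : N (posRealScalar 1 K t) = ((t : ℝ≥0) : ℝ) ^ d := by
      simp only [hN]
      rw [ideleNorm_det_posRealScalar, one_mul, NNReal.coe_pow]
    rw [h1, h2, Real.rpow_def_of_pos (pow_pos ht d), Real.log_pow, ← Real.exp_add]
    rw [show Real.log ((t : ℝ≥0) : ℝ) * c + (d : ℝ) * Real.log ((t : ℝ≥0) : ℝ) * -σ = 0 by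
      rw [hσ]; field_simp; ring]
    exact Real.exp_zero
  -- boundedness from reduction theory for `GL_1`
  obtain ⟨Ω, t, ht, -, hΩc, hdec⟩ := (reductionTheory_gl_holds 1 K).exists_mul_eq
  have hCc : IsCompact (closure Ω * (standardMaximalCompactGL 1 K :
      Set (GL (Fin 1) (AdeleRing (𝓞 K) K)))) :=
    hΩc.mul (isCompact_standardMaximalCompactGL 1 K)
  obtain ⟨B, hB⟩ := hCc.bddAbove_image hΦc.continuousOn
  have hbound : ∀ g, Φ g ≤ B := fun g => by
    obtain ⟨γ, hγ, z, hz, w₀, hw₀, a, ha, k, hk, hg⟩ := hdec g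
    have ha1 : a = 1 := eq_one_of_mem_siegelCone le_rfl ha
    rw [← hg, ha1, mul_one, map_mul, map_mul, map_mul, hΦrat γ hγ, hΦz z hz, one_mul, one_mul,
      ← map_mul]
    exact hB ⟨w₀ * k, Set.mul_mem_mul (subset_closure hw₀) hk, rfl⟩
  intro g
  have h1 := MonoidHom.eq_one_of_pos_of_bddAbove Φ hΦpos hbound g
  rw [hΦ] at h1
  have hNg := hNpos g
  calc ‖(detTwist 1 θ g : ℂ)‖ = ‖(detTwist 1 θ g : ℂ)‖ * N g ^ (-σ) * N g ^ σ := by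
        rw [mul_assoc, ← Real.rpow_add hNg, neg_add_cancel, Real.rpow_zero, mul_one]
    _ = N g ^ σ := by rw [h1, one_mul]

/-- **`|θ| = ‖·‖^σ` on ideles**: every idele class character of a number field is a unitary
character times a real power of the idele norm (`𝕀_K / 𝕀_K¹ ≅ ℝ_{>0}` and `𝕀_K¹/Kˣ` compact).
Weil, *Basic Number Theory*, Ch. VII §3; Tate (1950), §4.3. [cite: WeilBNT1967, Ch. IV §4, Thm. 6] -/
theorem _root_.Literature.NumberTheory.GaloisRepresentations.HeckeCharacter.exists_norm_apply_eq_ideleNorm_rpow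
    (θ : HeckeCharacter K) :
    ∃ σ : ℝ, ∀ x : ideleGroup K,
      ‖((θ x : ℂˣ) : ℂ)‖ = GaloisRepresentations.ideleNorm x ^ σ := by
  obtain ⟨σ, hσ⟩ := HeckeCharacter.exists_norm_detTwist_eq_ideleNorm_rpow
    (isCompact_glFiniteIntegralLevel_holds 1 K) θ
  refine ⟨σ, fun x => ?_⟩
  have h := hσ (Matrix.GeneralLinearGroup.scalar (Fin 1) x)
  rw [detTwist_apply, Matrix.GeneralLinearGroup.det_scalar, Fintype.card_fin, pow_one,
    coe_ideleNorm] at h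
  exact h

end Character


/-! ### Hecke characters as automorphic forms on `GL_1(𝔸_K)` (Borel–Jacquet 4.2) -/

section Forms

variable {K : Type} [Field K] [NumberField K] (hcpt : isCompact_glFiniteIntegralLevel 1 K)

/-- **Every Hecke character has a level** on `GL_1`: there is a non-zero ideal `𝔪` with
`θ ∘ det` trivial on the principal congruence subgroup `K(𝔪) ≤ GL_1(𝔸_K)` (continuity of `θ`,
`exists_principalCongruenceLevel_subset`, and "no small subgroups" in `ℂˣ`,
`HeckeCharacter.eq_one_of_norm_pow_sub_one_le`; a rank-one copy of
`HeckeCharacter.exists_level`). Tate (1950), Lemma 3.2.1. [cite: TateThesis1967, Ch. XV, Lemma 3.2.1] -/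
theorem _root_.Literature.NumberTheory.GaloisRepresentations.HeckeCharacter.exists_level_glOne
    (θ : HeckeCharacter K) :
    ∃ 𝔪 : Ideal (𝓞 K), 𝔪 ≠ 0 ∧ ∀ k ∈ principalCongruenceLevel 1 K 𝔪, detTwist 1 θ k = 1 := by
  set V : Set (GL (Fin 1) (AdeleRing (𝓞 K) K)) := {g | ‖(detTwist 1 θ g : ℂ) - 1‖ < 1 / 2} with hV
  have hcont : Continuous fun g : GL (Fin 1) (AdeleRing (𝓞 K) K) => ‖(detTwist 1 θ g : ℂ) - 1‖ :=
    ((Units.continuous_val.comp (continuous_detTwist 1 θ)).sub continuous_const).norm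
  have hU : V ∈ nhds (1 : GL (Fin 1) (AdeleRing (𝓞 K) K)) := by
    refine (isOpen_lt hcont continuous_const).mem_nhds ?_
    simp only [Set.mem_setOf_eq, detTwist_apply, map_one, Units.val_one, sub_self, norm_zero]
    norm_num
  obtain ⟨𝔪, h𝔪, hsub⟩ := exists_principalCongruenceLevel_subset 1 K hU
  refine ⟨𝔪, h𝔪, fun k hk => ?_⟩
  have hpow : ∀ j : ℕ, ‖((θ (Matrix.GeneralLinearGroup.det k) : ℂˣ) : ℂ) ^ j - 1‖ ≤ 1 / 2 := fun j => by
    have hkj := hsub (pow_mem hk j : k ^ j ∈ principalCongruenceLevel 1 K 𝔪)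
    simp only [hV, Set.mem_setOf_eq] at hkj
    rw [detTwist_apply, map_pow, map_pow, Units.val_pow_eq_pow_val] at hkj
    exact hkj.le
  rw [detTwist_apply]
  exact Units.val_eq_one.mp
    (GaloisRepresentations.HeckeCharacter.eq_one_of_norm_pow_sub_one_le (by norm_num) hpow)

/-- `(θ ∘ det) (g · h) = θ(det h) · (θ ∘ det)(g)`: right translates of `θ ∘ det` are its
multiples. [folklore] -/
theorem rightTranslation_detTwist_glOne (θ : HeckeCharacter K) (h : (AdelicGroupData.gl 1 K).Adelic) :
    rightTranslation (AdelicGroupData.gl 1 K) h (fun g => (detTwist 1 θ g : ℂ)) =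
      (detTwist 1 θ h : ℂ) • fun g => (detTwist 1 θ g : ℂ) := by
  funext g
  simp only [rightTranslation_apply, map_mul, Units.val_mul, Pi.smul_apply, smul_eq_mul, mul_comm]

/-- **The Lie derivative of `θ ∘ det` along `X ∈ 𝔤𝔩_1(K_∞)` is `δ(X) · (θ ∘ det)`**, `δ` the
archimedean differential of `θ` (`(θ∘det)(g exp tX) = (θ∘det)(g) e^{t δ(X)}`).
Borel–Jacquet 1979, §1.5. [folklore] -/
theorem lieDeriv_detTwist_glOne (θ : HeckeCharacter K)
    {δ : (AutomorphyDatum.gl 1 K hcpt).arch.lie →ₗ[ℝ] ℂ}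
    (hδ : ∀ X : (AutomorphyDatum.gl 1 K hcpt).arch.lie,
      (detTwist 1 θ ((AutomorphyDatum.gl 1 K hcpt).ofArch
        ((AutomorphyDatum.gl 1 K hcpt).arch.expMem X)) : ℂ) = Complex.exp (δ X))
    (X : (AutomorphyDatum.gl 1 K hcpt).arch.lie) :
    lieDeriv (AutomorphyDatum.gl 1 K hcpt).ofArch X (fun g => (detTwist 1 θ g : ℂ)) =
      δ X • fun g => (detTwist 1 θ g : ℂ) := by
  funext g
  simp only [lieDeriv, Pi.smul_apply, smul_eq_mul]
  have hfun : (fun t : ℝ => (detTwist 1 θ (g * (AutomorphyDatum.gl 1 K hcpt).ofArch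
      ((AutomorphyDatum.gl 1 K hcpt).arch.expMem (t • X))) : ℂ)) =
      fun t : ℝ => (detTwist 1 θ g : ℂ) * Complex.exp (δ X * t) := by
    funext t
    rw [map_mul, Units.val_mul, hδ, map_smul, Complex.real_smul, mul_comm (t : ℂ)]
  rw [hfun]
  have hd : HasDerivAt (fun t : ℝ => (detTwist 1 θ g : ℂ) * Complex.exp (δ X * t))
      ((detTwist 1 θ g : ℂ) * δ X) 0 := by
    have h1 : HasDerivAt (fun t : ℝ => δ X * (t : ℂ)) (δ X) 0 := by
      simpa using ((hasDerivAt_id (0 : ℝ)).ofReal_comp).const_mul (δ X)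
    simpa using h1.cexp.const_mul (detTwist 1 θ g : ℂ)
  rw [hd.deriv, mul_comm]

/-- Iterated Lie derivatives of `θ ∘ det` are multiples of `θ ∘ det`. [folklore] -/
theorem iterLieDeriv_detTwist_glOne (θ : HeckeCharacter K)
    {δ : (AutomorphyDatum.gl 1 K hcpt).arch.lie →ₗ[ℝ] ℂ}
    (hδ : ∀ X : (AutomorphyDatum.gl 1 K hcpt).arch.lie,
      (detTwist 1 θ ((AutomorphyDatum.gl 1 K hcpt).ofArch
        ((AutomorphyDatum.gl 1 K hcpt).arch.expMem X)) : ℂ) = Complex.exp (δ X))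
    (w : List (AutomorphyDatum.gl 1 K hcpt).arch.lie) :
    iterLieDeriv (AutomorphyDatum.gl 1 K hcpt).ofArch w (fun g => (detTwist 1 θ g : ℂ)) =
      (w.map δ).prod • fun g => (detTwist 1 θ g : ℂ) := by
  induction w with
  | nil => rw [iterLieDeriv_nil, List.map_nil, List.prod_nil, one_smul]
  | cons X w ih =>
    rw [iterLieDeriv_cons, ih, lieDeriv_smul, lieDeriv_detTwist_glOne hcpt θ hδ, smul_smul,
      List.map_cons, List.prod_cons, mul_comm]

/-- The word action of `U(𝔤)` on `θ ∘ det` stays in the line `ℂ · (θ ∘ det)`. [folklore] -/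
theorem applyFree_detTwist_glOne_mem (θ : HeckeCharacter K)
    (p : FreeAlgebra ℝ (AutomorphyDatum.gl 1 K hcpt).arch.lie) :
    applyFree (AutomorphyDatum.gl 1 K hcpt).ofArch p (fun g => (detTwist 1 θ g : ℂ)) ∈
      Submodule.span ℂ {fun g : (AdelicGroupData.gl 1 K).Adelic => (detTwist 1 θ g : ℂ)} := by
  obtain ⟨δ, hδ⟩ := exists_linearMap_detTwist_ofArch_expMem_glOne hcpt θ
  rw [applyFree, Finsupp.sum]
  refine Submodule.sum_mem _ fun w _ => Submodule.smul_mem _ _ ?_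
  rw [iterLieDeriv_detTwist_glOne hcpt θ hδ]
  exact Submodule.smul_mem _ _ (Submodule.mem_span_singleton_self _)

open scoped Matrix.Norms.Operator in
/-- Constant functions are smooth in the archimedean variable. [folklore] -/
theorem isArchSmooth_const_glOne (c : ℂ) :
    IsArchSmooth (AutomorphyDatum.gl 1 K hcpt).ofArch (fun _ : (AdelicGroupData.gl 1 K).Adelic => c) :=
  fun _ => contDiff_const

/-- **A Hecke character is an automorphic form on `GL_1(𝔸_K)`** in the sense of Borel–Jacquet
1979, 4.2: `g ↦ θ(det g)` is left `GL_1(K)`-invariant (`θ(Kˣ) = 1`), right invariant under a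
principal congruence level (`HeckeCharacter.exists_level_glOne`), smooth in the archimedean
variable (`θ(det(g exp X)) = θ(det g) e^{δ(X)}`), `K_∞`-finite and `Z(𝔤)`-finite (all its
translates and derivatives lie on the line `ℂ · θ∘det`), and of moderate growth
(`|θ(det g)| = ‖det g‖^σ ≤ C (1 ⊔ ‖g‖)^r`, `HeckeCharacter.exists_norm_detTwist_eq_ideleNorm_rpow`,
`exists_ideleNorm_det_rpow_le_height`). Gelbart, *Automorphic forms on adele groups* (1975),
§2.A (`GL(1)`: Hecke's Grössencharaktere as automorphic forms); Borel–Jacquet 1979, 4.2.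
[cite: BorelJacquet1979, 4.2] -/
theorem isAutomorphicForm_detTwist_glOne (θ : HeckeCharacter K) :
    IsAutomorphicForm (AutomorphyDatum.gl 1 K hcpt) (fun g => (detTwist 1 θ g : ℂ)) := by
  obtain ⟨δ, hδ⟩ := exists_linearMap_detTwist_ofArch_expMem_glOne hcpt θ
  haveI : FiniteDimensional ℝ (mixedEmbedding.mixedSpace K) := inferInstance
  refine ⟨?_, ?_, ?_, ?_, ?_, ?_⟩
  · -- left invariance under `GL_1(K)`
    intro γ hγ g
    change (detTwist 1 θ (γ * g) : ℂ) = detTwist 1 θ g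
    rw [map_mul, detTwist_eq_one_of_mem_arithmeticSubgroup 1 θ hγ, one_mul]
  · -- a level
    obtain ⟨𝔪, h𝔪, hθ𝔪⟩ := θ.exists_level_glOne
    refine ⟨principalCongruenceLevel 1 K 𝔪, ?_, fun u hu g => ?_⟩
    · rw [AutomorphyDatum.gl_finiteLevels]
      exact principalCongruenceLevel_mem_finiteLevelsGL_holds (n := 1) (K := K) h𝔪
    · change (detTwist 1 θ (g * u) : ℂ) = detTwist 1 θ g
      rw [map_mul, hθ𝔪 u hu, mul_one]
  · -- smoothness in the archimedean variable: `θ∘det = (θ∘det) · 1`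
    have h := isArchSmooth_mulChar_of_exp (AutomorphyDatum.gl 1 K hcpt).ofArch hδ
      (isArchSmooth_const_glOne hcpt 1)
    convert h using 1
    funext g
    rw [mulChar_apply, mul_one]
  · -- `K_∞`-finiteness: the translates span the line `ℂ · θ∘det`
    change FiniteDimensional ℂ (kTranslateSpan (AutomorphyDatum.gl 1 K hcpt).ofArch fun g => (detTwist 1 θ g : ℂ))
    refine Submodule.finiteDimensional_of_le (S₂ := Submodule.span ℂ {fun g : (AdelicGroupData.gl 1 K).Adelic =>
      (detTwist 1 θ g : ℂ)}) (Submodule.span_le.2 ?_)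
    rintro _ ⟨k, rfl⟩
    dsimp only
    rw [AutomorphyDatum.archTranslate_ofArch, rightTranslation_detTwist_glOne]
    exact Submodule.smul_mem _ _ (Submodule.mem_span_singleton_self _)
  · -- `Z(𝔤)`-finiteness: the `U(𝔤)`-orbit spans the line `ℂ · θ∘det`
    change FiniteDimensional ℂ (zOrbitSpan (AutomorphyDatum.gl 1 K hcpt).ofArch fun g => (detTwist 1 θ g : ℂ))
    refine Submodule.finiteDimensional_of_le (S₂ := Submodule.span ℂ {fun g : (AdelicGroupData.gl 1 K).Adelic =>
      (detTwist 1 θ g : ℂ)}) (Submodule.span_le.2 ?_)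
    rintro _ ⟨p, -, rfl⟩
    exact applyFree_detTwist_glOne_mem hcpt θ p
  · -- moderate growth
    obtain ⟨σ, hσ⟩ := HeckeCharacter.exists_norm_detTwist_eq_ideleNorm_rpow hcpt θ
    obtain ⟨C, r, -, hC⟩ := exists_ideleNorm_det_rpow_le_height (n := 1) (K := K) σ
    refine ⟨C, r, fun g => ?_⟩
    rw [AutomorphyDatum.gl_height]
    have h := hC g
    rw [← coe_ideleNorm] at h
    rw [hσ g]
    exact h

/-- **The automorphic representation of `GL_1(𝔸_K)` attached to a Hecke character**, in the
Borel–Jacquet model: the line `ℂ · (θ ∘ det)` over `⊥` is an automorphic representation datum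
`π_θ = W / W'` (`W = ℂ · θ∘det` is stable — translates and derivatives of `θ∘det` are its
multiples — and a line has no proper non-zero subspace). This is the rank-one dictionary
"automorphic representations of `GL(1)` = idèle class characters" (Gelbart 1975, §2.A;
Jacquet–Langlands 1970, §9; Borel–Jacquet 1979, 4.6). [cite: BorelJacquet1979, 4.6] -/
theorem exists_automorphicRepData_detTwist_glOne (θ : HeckeCharacter K) :
    ∃ π : AutomorphicRepData (AutomorphyDatum.gl 1 K hcpt),
      π.W = Submodule.span ℂ {fun g : (AdelicGroupData.gl 1 K).Adelic => (detTwist 1 θ g : ℂ)} ∧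
        π.W' = ⊥ := by
  obtain ⟨δ, hδ⟩ := exists_linearMap_detTwist_ofArch_expMem_glOne hcpt θ
  set ψ : (AdelicGroupData.gl 1 K).Adelic → ℂ := fun g => (detTwist 1 θ g : ℂ) with hψ
  have hψ0 : ψ ≠ 0 := fun h => by
    have := congrFun h 1
    simp only [hψ, map_one, Units.val_one, Pi.zero_apply] at this
    exact one_ne_zero this
  have hstable : IsStableSubmodule (AutomorphyDatum.gl 1 K hcpt) (Submodule.span ℂ {ψ}) :=
    { le_automorphicForms := Submodule.span_le.2 (by
        rintro _ rfl
        exact (isAutomorphicForm_detTwist_glOne hcpt θ).mem_automorphicForms)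
      finite_stable := fun h _ => Submodule.span_le.2 (by
        rintro _ rfl
        rw [SetLike.mem_coe, Submodule.mem_comap, hψ, rightTranslation_detTwist_glOne]
        exact Submodule.smul_mem _ _ (Submodule.mem_span_singleton_self _))
      k_stable := fun k => Submodule.span_le.2 (by
        rintro _ rfl
        rw [SetLike.mem_coe, Submodule.mem_comap, hψ, rightTranslation_detTwist_glOne]
        exact Submodule.smul_mem _ _ (Submodule.mem_span_singleton_self _))
      lie_stable := fun X φ hφ => by
        obtain ⟨a, rfl⟩ := Submodule.mem_span_singleton.1 hφ
        rw [lieDeriv_smul, hψ, lieDeriv_detTwist_glOne hcpt θ hδ, smul_smul]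
        exact Submodule.smul_mem _ _ (Submodule.mem_span_singleton_self _) }
  refine ⟨{ W := Submodule.span ℂ {ψ}
            W' := ⊥
            lt := bot_lt_iff_ne_bot.2 (by
              rw [Ne, Submodule.span_singleton_eq_bot]; exact hψ0)
            stable := hstable
            stable' := isStableSubmodule_bot _
            irreducible := fun W'' _ h₂ _ => ?_ }, rfl, rfl⟩
  rcases eq_or_lt_of_le h₂ with h | h
  · exact Or.inr h
  · exact Or.inl ((nonzero_span_atom ψ hψ0).2 _ h)

/-- In rank `1` the Hecke operator `[U t U]` on a `U`-fixed function is the single translation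
`r(t)` (`GL_1(𝔸_K)` is commutative, `U t U = t U`). [folklore] -/
theorem heckeOperator_rightTranslation_glOne (U : Subgroup (AdelicGroupData.gl 1 K).Adelic)
    (t : (AdelicGroupData.gl 1 K).Adelic) {φ : (AdelicGroupData.gl 1 K).Adelic → ℂ}
    (hφ : IsRightInvariantUnder U φ) :
    heckeOperator (rightTranslation (AdelicGroupData.gl 1 K)) U t φ =
      rightTranslation (AdelicGroupData.gl 1 K) t φ := by
  have horb : MulAction.orbit U (t : (AdelicGroupData.gl 1 K).Adelic ⧸ U) = {(t : _ ⧸ U)} := by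
    ext y
    simp only [Set.mem_singleton_iff, MulAction.mem_orbit_iff]
    constructor
    · rintro ⟨k, rfl⟩
      change (((k : (AdelicGroupData.gl 1 K).Adelic) * t : (AdelicGroupData.gl 1 K).Adelic) : _ ⧸ U) = (t : _ ⧸ U)
      rw [show (k : (AdelicGroupData.gl 1 K).Adelic) * t = t * k from
        (commute_gl_fin_one (k : (AdelicGroupData.gl 1 K).Adelic) t).eq, QuotientGroup.mk_mul_of_mem t k.2]
    · rintro rfl
      exact MulAction.mem_orbit_self _
  have hbij : Set.BijOn (fun x : (AdelicGroupData.gl 1 K).Adelic => (x : _ ⧸ U))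
      ({t} : Finset (AdelicGroupData.gl 1 K).Adelic) (MulAction.orbit U (t : _ ⧸ U)) := by
    rw [Finset.coe_singleton, horb]
    exact Set.bijOn_singleton.mpr rfl
  rw [heckeOperator_apply_eq_sum _ U t {t} hbij ((isRightInvariantUnder_iff_mem_fixedPoints (AdelicGroupData.gl 1 K) U φ).1 hφ),
    Finset.sum_singleton]

/-- The Hecke element `t_{w,1} = (ϖ at w, 1 elsewhere) ∈ GL_1(𝔸_K)` has determinant the local
idele `⟨ϖ⟩_w` (`det_heckeDiagAt`). [folklore] -/
theorem detTwist_heckeDiagAt_one_glOne (θ : HeckeCharacter K) (w : HeightOneSpectrum (𝓞 K))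
    (ϖ : (w.adicCompletion K)ˣ) :
    detTwist 1 θ (heckeDiagAt 1 K w ϖ 1) = θ (localUnits w ϖ) := by
  rw [detTwist_apply, det_heckeDiagAt w ϖ le_rfl, pow_one]

/-- **Satake parameters of `π_θ`**: if `θ ∘ det` is trivial on `K(𝔪)` (`𝔪 ≠ 0`), then at every
finite place `w ∤ 𝔪` and for every uniformizer `ϖ` of `K_w`, the datum `π_θ = ℂ·(θ∘det) / ⊥` has
Satake parameter `{θ(⟨ϖ⟩_w)}` at `w`: `θ∘det` is `K(𝔪)`-fixed, `T_{w,0} = 1` and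
`T_{w,1} (θ∘det) = r(t_{w,1}) (θ∘det) = θ(det t_{w,1}) · θ∘det = θ(⟨ϖ⟩_w) · θ∘det`.
Tate (1950), §2.3–2.5 (unramified quasi-characters `|ϖ|^s`); Borel–Jacquet 1979, 4.6; Bump §3.3. [cite: BorelJacquet1979, 4.6] -/
theorem AutomorphicRepData.hasSatakeParamAt_detTwist_glOne {θ : HeckeCharacter K}
    {π : AutomorphicRepData (AutomorphyDatum.gl 1 K hcpt)}
    (hW : π.W = Submodule.span ℂ {fun g : (AdelicGroupData.gl 1 K).Adelic => (detTwist 1 θ g : ℂ)})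
    (hW' : π.W' = ⊥) {𝔪 : Ideal (𝓞 K)} (h𝔪 : 𝔪 ≠ 0)
    (hθ𝔪 : ∀ k ∈ principalCongruenceLevel 1 K 𝔪, detTwist 1 θ k = 1)
    (w : HeightOneSpectrum (𝓞 K)) (hw : ¬ w.asIdeal ∣ 𝔪) {ϖ : (w.adicCompletion K)ˣ}
    (hϖ : Valued.v (ϖ : w.adicCompletion K) = WithZero.exp (-1 : ℤ)) :
    π.HasSatakeParamAt w {((θ (localUnits w ϖ) : ℂˣ) : ℂ)} := by
  set ψ : (AdelicGroupData.gl 1 K).Adelic → ℂ := fun g => (detTwist 1 θ g : ℂ) with hψ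
  have hθ𝔪' : ∀ k ∈ principalCongruenceLevel 1 K 𝔪, θ (Matrix.GeneralLinearGroup.det k) = 1 :=
    fun k hk => by rw [← detTwist_apply]; exact hθ𝔪 k hk
  have hfix : IsRightInvariantUnder (principalCongruenceLevel 1 K 𝔪) ψ := fun u hu g => by
    simp only [hψ]
    rw [detTwist_apply, detTwist_apply, map_mul, map_mul, hθ𝔪' u hu, mul_one]
  have hψ0 : ψ ≠ 0 := fun h => by
    have := congrFun h 1
    simp only [hψ, map_one, Units.val_one, Pi.zero_apply] at this
    exact one_ne_zero this
  refine ⟨𝔪, ϖ, h𝔪, hw, hϖ, by simp, ψ, ?_, ?_, fun u hu => funext fun g => hfix u hu g, fun i hi => ?_⟩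
  · rw [hW]; exact Submodule.mem_span_singleton_self _
  · rw [hW']; exact hψ0
  rw [hW', Submodule.mem_bot, heckeOperator_rightTranslation_glOne _ _ hfix, hψ,
    rightTranslation_detTwist_glOne, ← sub_smul, smul_eq_zero]
  left
  rcases Nat.le_one_iff_eq_zero_or_eq_one.1 hi with rfl | rfl
  · simp [heckeDiagAt_zero, Multiset.esymm]
  · rw [detTwist_heckeDiagAt_one_glOne]
    simp [Multiset.esymm, Multiset.powersetCard_one]

end Forms

end Literature.NumberTheory.Automorphic
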